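import Summits.CriticalPhenomena.CardyFormulaZ2.Theses.CardySelfRefinement
import Literature.Probability.Percolation.QuadCrossingPushforward
import Literature.Probability.LatticeModels.ProdBernoulliCoupling
import Literature.Probability.LatticeModels.ThermodynamicLimit
import Literature.Probability.Percolation.ProdBernoulliRusso

/-!
# Disproof work file — `GradientComparability` (stmt-CriticalPhenomena-10269), cdisprove gen 2

Crux (route CardySelfRefinement, rank 5, L): for `k ∈ {2,3}`, every RSW path `γ : (1,0) → (0,½)`
of the self-refinement bond model `M_k(ρ,c)` and every nonempty finite quad family `F`:
the Russo-gradient size `G(s,η) = |∂ρP| + |∂cP|` of the joint crossing probability at mesh `η`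
is (C) comparable up to one constant `Λ` between any two path points at equal mesh, for all small
`η`, and (D) tends to `+∞` uniformly in `s`.

## Findings (gen 2, 2026-08-15/16) — index
* §1 named model + DEFINITIONAL bridges `gradientComparability_iff`, `criticalPathRSW_iff`
  (`Iff.rfl`; `ax` must stay an `abbrev`).
* §2 **VERDICT ON REFUTABILITY: armoured by its hypothesis.**
  `exists_pathOK_of_not_gradientComparability`: any refutation exhibits `γ` with `PathOK k γ`,
  i.e. proves `CriticalPathRSW` (stmt-10267, XL, open) for `k = 2` or `3`;
  `gradientComparability_of_no_path`: if no RSW path exists the crux is vacuously TRUE.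
  So before 10267 is settled the crux can be neither refuted nor non-vacuously proved in Lean.
* §3 **mutation / reformulation (checked):** the conclusion sees only the IMAGE of `γ`
  (`conclusion_iff_conclusionOn_range`; continuity/BV/parametrisation are decoration HERE) and is
  EQUIVALENT to the envelope form `∃ h → ∞, h/Λ ≤ G(q,η) ≤ Λh on range γ`
  (`conclusionOn_iff_envelopeOn`, `gradientComparability_iff_envelope`): the crux is exactly
  "universality of the pivotal scale `h(η) ≍ η⁻²π₄(η⁻¹)` UP TO CONSTANTS along the critical
  family" — no exponent needs to exist.
* §4 **load-bearing `0 < m` (checked):** `withoutPosM_iff_noPath` — with the empty family allowed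
  the crux is equivalent to "no RSW path exists" (`P ≡ 1`, `∇P ≡ 0`; uses `measurable_cfg`, so
  `M k ρ c` is an honest probability measure, no `Measure.map` junk).
* §5 **endpoint content (checked):** `gradientComparability_endpoints'` — given an RSW path the
  crux forces `DivergesAt (1,0)`, `DivergesAt (0,½)` and two-point comparability for the two
  explicit Bernoulli models (coarse `P_{1/2}` refined, and `P_{1/2}`).  On paper these are TRUE
  (Reimer/BK: `n²π₄(n) ≥ n²π₅(n)/π₁(n) ≥ n^{c}` on bond-`ℤ²`; quasi-multiplicativity
  `π₄(kn) ≍ π₄(n)`), so the endpoints cannot refute the crux.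
* §5b **structure (checked):** `isUpperSet_A` (joint crossing event increasing);
  `M_apply_mono_c` / `P_mono_c` (label coupling through the non-monotone read-out: `M_k(ρ,·)` is
  stochastically increasing in `c` on increasing measurable events); `Dc_nonneg` (`∂cP ≥ 0`, so
  `G = |∂ρP| + ∂cP`) — the last two GIVEN `MeasurableSet (A m F η)`, which is not in the tree
  (prerequisite for every Russo argument on this route; without it `P` is an outer measure).
* §5c **support (checked):** `cfg_subset_edgeSet`, `M_nnSupport` (`M_k(ρ,c)` lives on
  nearest-neighbour configurations), `M_eq_inter_nnSupport` / `P_eq_inter_nnSupport` (every set,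
  measurable or not, has the mass of its trace on `nnSupport`).
* §5d **localisation + measurability (checked, standard axioms):** `mem_configOf_iff_of_sandwich`
  (crossing of `Q` in the closure sense depends only on the pairs drawn through the
  `1`-thickening of `[Q]`: uniform quad metric + `IsCrossing ⊆ [Q']`); `edgesNear_finite`
  (for `η ≠ 0` finitely many n.n. edges are drawn through a bounded set); `mem_A_iff_inter_window`,
  `measurableSet_A_inter_nnSupport`, `P_eq_real_Aloc` (`P` is the probability of a genuine
  finite-dimensional increasing cylinder `Aloc`), hence UNCONDITIONAL `P_mono_c'`, `Dc_nonneg'`,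
  `G_eq_of_ne_zero : G = |∂ρP| + ∂cP` on `η ≠ 0`.  This discharges the measurability
  prerequisite below for the events of this crux and hands provers the Russo entry point.
* §5e **coin-side pullback (checked):** `determinedBy_preimage_Aloc` (the pulled-back event is
  determined by the finite `coinWindow`: each edge reads ≤ 3 coins), `P_eq_sum_powerset` (`P` =
  finite sum of coin-cylinder weights = multilinear polynomial in the biases
  `½, projIcc c, projIcc ρ`), `continuous_P` (so for fixed `η` comparability along the compact path
  is automatic once `min_s G > 0`: ALL content of the crux is uniformity as `η → 0`).
* §6 **near-miss (1 sorry):** `gradientComparability_false_without_upperRSW` — the UPPER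
  box-crossing bound is load-bearing (supercritical detour through `c = 1`, where `∇P = 0`
  exactly); statement fixed, proof plan and obstruction in its docstring.
* §7 (docstring only) Monte-Carlo falsifier on `M_2` — kit job j006600 (see below; numbers are
  filled in when the job returns).

## Gen-1 inventory (refuter-cdisprove-stmt-CriticalPhenomena-10269-0; item evidence
`Disproof.lean` v1–v4, 22:21Z–22:48Z, v4 sha256 a17c7010563b2d10, 1324 lines, rc0, 0 sorry; NOT
readable from the compute-free hub this generation ran on, hence the rebuild above):
measurable_cfg; withoutPosM_iff_noPath; ¬GradientComparabilityWithoutRSW (drop BOTH bounds: path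
through `c = 1`, `F = {unit square}`, odd rows open ⇒ `P(ρ',1) = 1`, `|P(ρ,c') − 1| ≤ (N+1)²(c'−1)²`
⇒ `∇P = 0` for `η ≤ 1/5`); prodBernoulli_cyl, edge_mem_cfg, hSeg_subset_realization,
isCrossing_hSeg, unitSquare_mem_configOf_of_row, P_ge_of_rows; map_cfgF_eq_bondPercolation,
M_zero_half_eq (`M k 0 ½ = P_{1/2}`), M_one_zero_eq (`M k 1 0 = P_{1/2}.map (refine k)`),
M_one_eq + pathOK_one + not_gradientComparabilityAt_one (the guard `k = 2 ∨ k = 3` is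
load-bearing: at `k = 1` the model is `P_{1/2}` for all `(ρ,c)`, `∇P ≡ 0`, yet `PathOK 1` holds by
the tree's PROVED `square_boxCrossing_holds`); conclusion_iff_on_range, ComparabilityOnRSWSets,
rswOn_zero_half, gradientComparability_endpoints.

## Paper analysis (why it resists; what would kill it)
1. `∂cP` at `(1,0)`: Russo in the own coins of interior edges; opening one interior edge at `c = 0`
   adds a dangling stub, which completes a GEOMETRIC quad crossing only when it touches an arc:
   `∂cP(1,0) ≍ η⁻¹ · (boundary 3-arm, exponent 2) ≍ η^{+1} → 0` (and `= 0` exactly for graph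
   crossings).  So `G(1,0) = |∂ρP| + o(1)` with `∂ρP(1,0) = (½ − 2^{-k}) Σ_g P(coarse edge g
   pivotal) + O(boundary) ≍ η⁻²π₄`: the projective/sum form of the crux is the right one; a
   variant with `|∂cP|` alone would be FALSE at `s = 0`.
2. `∂ρP` at `(0,½)` (`k = 2`): `¼ Σ_g E[Δ_{e₁}Δ_{e₂} 1_A]` = (series pairs) − (parallel pairs), both
   `≍ η⁻²π₄` with lattice-level coefficients — sign not determined a priori, may even cancel at
   leading order; harmless since `∂cP(0,½) = ½·E[#pivotal edges of P_{1/2}] ≍ η⁻²π₄ > 0`.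
3. Interior points: `∂cP = Σ_{interior e} P(e pivotal) ≍ c·η⁻²π₄^{(ρ,c)}(η⁻¹)` and near the
   corner `ρ → 1` (`c* → 0`) `∂ρP` carries the full order, so (C)+(D) ⟺ `π₄^{(s)}(n) ≍ π₄^{(s')}(n)`
   uniformly along the critical family + `n²π₄^{(s)}(n) → ∞` uniformly.  (D) follows on paper from
   uniform RSW by Reimer on the COIN product space (block-disjoint arms) — true with work;
   (C) is universality of the 4-arm scale up to constants for a non-isoradial finitely dependent
   family — no transport mechanism in print (Grimmett–Manolescu 2013/14 cover star–triangle
   related isoradial Bernoulli models only).  A refutation needs two points of ONE RSW set whose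
   4-arm scales separate by more than constants along a sequence of equal meshes — i.e. a
   violation of universality inside the percolation class; nobody expects one, and none can be
   certified without first proving RSW along the path.
4. Degenerate quads are washed out: `configOf` is the CLOSURE of the raw crossed-quad set, so
   quads with axis-inaccessible arcs are still "crossed" in the limit sense; no degenerate `F`
   with `m ≥ 1` makes `P` constant.
5. Negatives index / barrier catalogue (EmbeddingModulusUniqueness, CoveringLatticeShift(‑Narrow),
   ScaleCovarianceNotMoebius): none bites an equal-mesh comparability statement inside one family.

## §7 Monte-Carlo (kit job j006600, PENDING at publication time)
`M_2` on the fine box `{0..L}²`, LR graph crossing; exact (non-finite-difference) estimators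
`∂cP = E[#closed interior edges joining an L-cluster to an R-cluster]/(1−c)`,
`∂ρP = ¼E[Σ_{closed pairs}(A₁₁−A₁₀−A₀₁+A₀₀)]/P(pair closed)`; stages `L = 32…512`; reports the
finite-size critical curve `c_half(ρ,L)`, `G` along it, `max_c G`, ratios between path points at
equal `L` (comparability ⟺ no drift in `L`) and growth exponents `log₂(G_L/G_{L/2})` (→ ¾ expected).

## Measurability of the crossing event (prerequisite of every Russo step) — DONE in §5c–§5d
`A m F η` is not obviously measurable on all of `Set (Sym2 ℤ²)` (the realisation draws a segment for
EVERY pair in `ω`), but `M_k(ρ,c)` lives on `nnSupport = {ω ⊆ n.n. edges}` (§5c) and there the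
event is decided by the finite window `window m F η` (§5d), so
`P k m F η ρ c = (M k ρ c).real (Aloc m F η)` with `Aloc` a measurable increasing finite cylinder.
What provers still need: pull `Aloc` back through `cfg k` (finitary: each edge reads ≤ 3 coins) to
a coin event `DeterminedBy` a finite coin set, and a Russo formula for the NON-monotone selector
coordinates (the tree's `hasDerivAt_prodBernoulli_real` assumes `IsUpperSet`; for `∂ρ` use the
multilinear-polynomial form `prodBernoulli_real_eq_sum_powerset` and differentiate term-wise).

## Recommendations to planner / provers
* The item is unfalsifiable and only vacuously provable until `CriticalPathRSW` (10267) lands;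
  schedule accordingly (prove 10267's `k = 2` half first, or restate this crux on RSW SETS:
  `∀ R ⊆ [0,1]², (two-sided box-crossing bounds uniform on R) → EnvelopeOn k R m F`, which is
  path-free, has provable instances today (`R = {(0,½)}` via `square_boxCrossing_holds`), and is
  what `RussoDrift` actually consumes).
* Keep the sum `|∂ρP| + |∂cP|` (item 1 above); keep `0 < m`; keep two-sided bounds.
-/

noncomputable section

namespace Summit.CriticalPhenomena.CardyFormulaZ2.Cruxes.GradientComparability.Disproof

open scoped BigOperators Topology Classical MeasureTheory ProbabilityTheory
open Filter Set Function TopologicalSpace MeasureTheory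
open Literature.Probability.LatticeModels Literature.Probability.Percolation
open Literature.Probability.Percolation.QuadCrossing
open Summit.CriticalPhenomena.CardyFormulaZ2.Theses.CardySelfRefinement

/-! ## §1 The model, named (definitionally equal to the `let`-chain of the route file) -/

/-- axial fine edge: `(v,d)` lies on a line of the coarse lattice `kℤ²`
(must stay an `abbrev`: the route's `if ax k e` is decided by `Int.decidableDvd`). -/
abbrev ax (k : ℕ) (e : Site 2 × Fin 2) : Prop := (k : ℤ) ∣ e.1 (if e.2 = 0 then 1 else 0)
/-- coarse base vertex (floor division of both coordinates by `k`; `Int` `/` is `ediv`). -/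
abbrev tb (k : ℕ) (e : Site 2 × Fin 2) : Site 2 := fun i => e.1 i / (k : ℤ)
/-- read-out of the fine edge `(v,d)` from the coin set `S`
(selector on ⇒ shared coin of the coarse edge, selector off ⇒ own coin). -/
abbrev opn (k : ℕ) (S : Set (Site 2 × Fin 2 × Fin 3)) (e : Site 2 × Fin 2) : Prop :=
  if ax k e then ((tb k e, e.2, (2 : Fin 3)) ∈ S ∧ (tb k e, e.2, (1 : Fin 3)) ∈ S) ∨
    ((tb k e, e.2, (2 : Fin 3)) ∉ S ∧ (e.1, e.2, (0 : Fin 3)) ∈ S)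
  else (e.1, e.2, (0 : Fin 3)) ∈ S
/-- coins ↦ bond configuration. -/
abbrev cfg (k : ℕ) (S : Set (Site 2 × Fin 2 × Fin 3)) : BondConfig (Site 2) :=
  {e | ∃ (v : Site 2) (d : Fin 2), e = s(v, v + (if d = 0 then ![1, 0] else ![0, 1])) ∧ opn k S (v, d)}
/-- coin biases: own coin (`j=0`: fair if axial, `c` otherwise), shared (`j=1`: fair),
selector (`j=2`: `ρ`). -/
abbrev prm (k : ℕ) (ρ c : ℝ) (i : Site 2 × Fin 2 × Fin 3) : unitInterval :=
  if i.2.2 = 0 then (if ax k (i.1, i.2.1) then half else Set.projIcc (0 : ℝ) 1 zero_le_one c)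
  else if i.2.2 = 1 then half else Set.projIcc (0 : ℝ) 1 zero_le_one ρ
/-- the law `M_k(ρ,c)` on bond configurations of `ℤ²`. -/
abbrev M (k : ℕ) (ρ c : ℝ) : Measure (BondConfig (Site 2)) := (prodBernoulli (prm k ρ c)).map (cfg k)
/-- joint crossing event of the quad family `F` at mesh `η`. -/
abbrev A (m : ℕ) (F : Fin m → Quad (Set.univ : Set ℂ)) (η : ℝ) : Set (BondConfig (Site 2)) :=
  {ω | ∀ i, F i ∈ configOf squareLatticeEmbedding.z η Set.univ ω}
/-- joint crossing probability. -/
abbrev P (k m : ℕ) (F : Fin m → Quad (Set.univ : Set ℂ)) (η ρ c : ℝ) : ℝ := (M k ρ c).real (A m F η)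
/-- Russo derivative in `ρ` (within `[0,1]`). -/
abbrev Dρ (k m : ℕ) (F : Fin m → Quad (Set.univ : Set ℂ)) (η : ℝ) (q : ℝ × ℝ) : ℝ :=
  derivWithin (fun ρ' => P k m F η ρ' q.2) (Set.Icc 0 1) q.1
/-- Russo derivative in `c` (within `[0,1]`). -/
abbrev Dc (k m : ℕ) (F : Fin m → Quad (Set.univ : Set ℂ)) (η : ℝ) (q : ℝ × ℝ) : ℝ :=
  derivWithin (fun c' => P k m F η q.1 c') (Set.Icc 0 1) q.2
/-- gradient size `G = |∂ρP| + |∂cP|`. -/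
abbrev G (k m : ℕ) (F : Fin m → Quad (Set.univ : Set ℂ)) (η : ℝ) (q : ℝ × ℝ) : ℝ :=
  |Dρ k m F η q| + |Dc k m F η q|
/-- admissible (RSW) paths: continuous, `(1,0) → (0,½)`, inside the unit square, BV coordinates,
TWO-SIDED box-crossing bounds uniform in `s` for every aspect ratio. -/
def PathOK (k : ℕ) (γ : unitInterval → ℝ × ℝ) : Prop :=
  Continuous γ ∧ γ 0 = (1, 0) ∧ γ 1 = (0, 1 / 2) ∧ (∀ s, γ s ∈ Set.Icc (0 : ℝ) 1 ×ˢ Set.Icc (0 : ℝ) 1) ∧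
    BoundedVariationOn (fun s => (γ s).1) Set.univ ∧ BoundedVariationOn (fun s => (γ s).2) Set.univ ∧
    ∀ a : ℝ, 0 < a → ∃ c₀ > 0, ∃ n₀ : ℕ, ∀ s,
      BoxCrossingBounds (M k (γ s).1 (γ s).2) squareLatticeEmbedding.z a c₀ n₀
/-- the conclusion of the crux for one `(k, γ, m, F)`: comparability + uniform divergence. -/
def Conclusion (k : ℕ) (γ : unitInterval → ℝ × ℝ) (m : ℕ) (F : Fin m → Quad (Set.univ : Set ℂ)) :
    Prop :=
  ∃ Λ η₀ : ℝ, 0 < η₀ ∧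
    (∀ s s' : unitInterval, ∀ η ∈ Set.Ioo 0 η₀, G k m F η (γ s) ≤ Λ * G k m F η (γ s')) ∧
    ∀ N : ℝ, ∃ η₁ : ℝ, 0 < η₁ ∧ ∀ η ∈ Set.Ioo 0 η₁, ∀ s : unitInterval, N ≤ G k m F η (γ s)

/-- **Definitional bridge.** The crux is literally
`∀ k ∈ {2,3}, ∀ RSW paths γ, ∀ nonempty finite quad families, Conclusion k γ m F`. -/
theorem gradientComparability_iff :
    GradientComparability ↔ ∀ k : ℕ, k = 2 ∨ k = 3 → ∀ γ : unitInterval → ℝ × ℝ, PathOK k γ →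
      ∀ (m : ℕ) (F : Fin m → Quad (Set.univ : Set ℂ)), 0 < m → Conclusion k γ m F :=
  Iff.rfl

/-- Bridge for the sibling crux `CriticalPathRSW` (stmt-10267; same `PathOK`). -/
theorem criticalPathRSW_iff :
    CriticalPathRSW ↔ ∀ k : ℕ, k = 2 ∨ k = 3 → ∃ γ : unitInterval → ℝ × ℝ, PathOK k γ :=
  Iff.rfl

/-! ## §2 Why no cheap refutation exists: every witness against the crux is an RSW path -/

/-- **Any refutation of `GradientComparability` exhibits an RSW path**, i.e. proves
`CriticalPathRSW` (stmt-10267, XL) for `k = 2` or `k = 3`.  So the crux cannot be refuted in Lean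
before an RSW path through the self-refinement family is constructed. -/
theorem exists_pathOK_of_not_gradientComparability (h : ¬ GradientComparability) :
    ∃ k : ℕ, (k = 2 ∨ k = 3) ∧ ∃ γ : unitInterval → ℝ × ℝ, PathOK k γ := by
  by_contra h'
  exact h (gradientComparability_iff.2 fun k hk γ hγ => (h' ⟨k, hk, γ, hγ⟩).elim)

/-- **Vacuity.** If no RSW path exists for `k = 2, 3` (i.e. `CriticalPathRSW` fails for both),
the crux holds for lack of instances. -/
theorem gradientComparability_of_no_path (h : ∀ k : ℕ, k = 2 ∨ k = 3 → ∀ γ, ¬ PathOK k γ) :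
    GradientComparability :=
  gradientComparability_iff.2 fun k hk γ hγ => (h k hk γ hγ).elim

/-- The two explicit endpoint models lie on every admissible path. -/
theorem endpoints_mem_range {k : ℕ} {γ : unitInterval → ℝ × ℝ} (hγ : PathOK k γ) :
    ((1 : ℝ), (0 : ℝ)) ∈ Set.range γ ∧ ((0 : ℝ), (1 / 2 : ℝ)) ∈ Set.range γ :=
  ⟨⟨0, hγ.2.1⟩, ⟨1, hγ.2.2.1⟩⟩

/-! ## §3 Mutation: the conclusion only sees the IMAGE of `γ`; envelope (universality) form -/

/-- The conclusion stated for a parameter SET `R ⊆ [0,1]²` instead of a path. -/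
def ConclusionOn (k : ℕ) (R : Set (ℝ × ℝ)) (m : ℕ) (F : Fin m → Quad (Set.univ : Set ℂ)) : Prop :=
  ∃ Λ η₀ : ℝ, 0 < η₀ ∧
    (∀ q ∈ R, ∀ q' ∈ R, ∀ η ∈ Set.Ioo 0 η₀, G k m F η q ≤ Λ * G k m F η q') ∧
    ∀ N : ℝ, ∃ η₁ : ℝ, 0 < η₁ ∧ ∀ η ∈ Set.Ioo 0 η₁, ∀ q ∈ R, N ≤ G k m F η q

/-- **Continuity, bounded variation and the parametrisation are decoration for THIS crux**: the
conclusion depends on `γ` only through its range (they matter for `RussoDrift`, not here). -/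
theorem conclusion_iff_conclusionOn_range (k : ℕ) (γ : unitInterval → ℝ × ℝ) (m : ℕ)
    (F : Fin m → Quad (Set.univ : Set ℂ)) :
    Conclusion k γ m F ↔ ConclusionOn k (Set.range γ) m F := by
  unfold Conclusion ConclusionOn
  constructor
  · rintro ⟨Λ, η₀, hη₀, hcomp, hdiv⟩
    refine ⟨Λ, η₀, hη₀, ?_, fun N => ?_⟩
    · rintro q ⟨s, rfl⟩ q' ⟨s', rfl⟩ η hη
      exact hcomp s s' η hη
    · obtain ⟨η₁, hη₁, h⟩ := hdiv N
      refine ⟨η₁, hη₁, ?_⟩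
      rintro η hη q ⟨s, rfl⟩
      exact h η hη s
  · rintro ⟨Λ, η₀, hη₀, hcomp, hdiv⟩
    refine ⟨Λ, η₀, hη₀, fun s s' η hη => hcomp _ ⟨s, rfl⟩ _ ⟨s', rfl⟩ η hη, fun N => ?_⟩
    obtain ⟨η₁, hη₁, h⟩ := hdiv N
    exact ⟨η₁, hη₁, fun η hη s => h η hη _ ⟨s, rfl⟩⟩

/-- `ConclusionOn` is antitone in the parameter set. -/
theorem ConclusionOn.mono {k : ℕ} {R R' : Set (ℝ × ℝ)} {m : ℕ} {F : Fin m → Quad (Set.univ : Set ℂ)}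
    (h : ConclusionOn k R m F) (hR : R' ⊆ R) : ConclusionOn k R' m F := by
  obtain ⟨Λ, η₀, hη₀, hcomp, hdiv⟩ := h
  refine ⟨Λ, η₀, hη₀, fun q hq q' hq' η hη => hcomp q (hR hq) q' (hR hq') η hη, fun N => ?_⟩
  obtain ⟨η₁, hη₁, h⟩ := hdiv N
  exact ⟨η₁, hη₁, fun η hη q hq => h η hη q (hR hq)⟩

/-- **Envelope form** ("`G ≍ h(η)` uniformly on `R`, with one divergent scale function `h`"):
the universality-up-to-constants reading of the crux. -/
def EnvelopeOn (k : ℕ) (R : Set (ℝ × ℝ)) (m : ℕ) (F : Fin m → Quad (Set.univ : Set ℂ)) : Prop :=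
  ∃ (h : ℝ → ℝ) (Λ η₀ : ℝ), 0 < Λ ∧ 0 < η₀ ∧
    (∀ η ∈ Set.Ioo 0 η₀, ∀ q ∈ R, h η ≤ Λ * G k m F η q ∧ G k m F η q ≤ Λ * h η) ∧
    ∀ N : ℝ, ∃ η₁ : ℝ, 0 < η₁ ∧ ∀ η ∈ Set.Ioo 0 η₁, N ≤ h η

/-- **The crux's conclusion on a nonempty parameter set is EQUIVALENT to the envelope form**:
comparability + uniform divergence ⟺ there is one function `h(η) → +∞` with
`h/Λ ≤ G(q,η) ≤ Λ h` for all `q ∈ R` and small `η`.  (Any proof will produce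
`h(η) = η⁻² π₄(η⁻¹)`-type envelopes; any disproof must separate two points of `R` by more than
constants at a sequence of equal meshes.) -/
theorem conclusionOn_iff_envelopeOn {k : ℕ} {R : Set (ℝ × ℝ)} {m : ℕ}
    {F : Fin m → Quad (Set.univ : Set ℂ)} (hR : R.Nonempty) :
    ConclusionOn k R m F ↔ EnvelopeOn k R m F := by
  obtain ⟨q₀, hq₀⟩ := hR
  constructor
  · rintro ⟨Λ, η₀, hη₀, hcomp, hdiv⟩
    obtain ⟨η₁, hη₁, h1⟩ := hdiv 1
    have hG0 : ∀ η ∈ Set.Ioo 0 (min η₀ η₁), 0 < G k m F η q₀ := fun η hη =>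
      lt_of_lt_of_le one_pos (h1 η ⟨hη.1, lt_of_lt_of_le hη.2 (min_le_right _ _)⟩ q₀ hq₀)
    have hΛ : ∀ η ∈ Set.Ioo 0 (min η₀ η₁), 1 ≤ Λ := by
      intro η hη
      have := hcomp q₀ hq₀ q₀ hq₀ η ⟨hη.1, lt_of_lt_of_le hη.2 (min_le_left _ _)⟩
      have hpos := hG0 η hη
      by_contra hlt
      rw [not_le] at hlt
      nlinarith
    refine ⟨fun η => G k m F η q₀, max Λ 1, min η₀ η₁, lt_of_lt_of_le one_pos (le_max_right _ _),
      lt_min hη₀ hη₁, fun η hη q hq => ⟨?_, ?_⟩, fun N => ?_⟩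
    · have := hcomp q₀ hq₀ q hq η ⟨hη.1, lt_of_lt_of_le hη.2 (min_le_left _ _)⟩
      have hG : 0 ≤ G k m F η q := by positivity
      calc G k m F η q₀ ≤ Λ * G k m F η q := this
        _ ≤ max Λ 1 * G k m F η q := by gcongr; exact le_max_left _ _
    · have := hcomp q hq q₀ hq₀ η ⟨hη.1, lt_of_lt_of_le hη.2 (min_le_left _ _)⟩
      have hG : 0 ≤ G k m F η q₀ := by positivity
      calc G k m F η q ≤ Λ * G k m F η q₀ := this
        _ ≤ max Λ 1 * G k m F η q₀ := by gcongr; exact le_max_left _ _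
    · obtain ⟨η₂, hη₂, h2⟩ := hdiv N
      exact ⟨η₂, hη₂, fun η hη => h2 η hη q₀ hq₀⟩
  · rintro ⟨h, Λ, η₀, hΛ, hη₀, henv, hdiv⟩
    refine ⟨Λ * Λ, η₀, hη₀, fun q hq q' hq' η hη => ?_, fun N => ?_⟩
    · have h1 := (henv η hη q hq).2
      have h2 := (henv η hη q' hq').1
      calc G k m F η q ≤ Λ * h η := h1
        _ ≤ Λ * (Λ * G k m F η q') := by gcongr
        _ = Λ * Λ * G k m F η q' := by ring
    · obtain ⟨η₁, hη₁, hN⟩ := hdiv (Λ * N)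
      refine ⟨min η₀ η₁, lt_min hη₀ hη₁, fun η hη q hq => ?_⟩
      have h1 := (henv η ⟨hη.1, lt_of_lt_of_le hη.2 (min_le_left _ _)⟩ q hq).1
      have h2 := hN η ⟨hη.1, lt_of_lt_of_le hη.2 (min_le_right _ _)⟩
      nlinarith

/-- Envelope form of the whole crux (the shape a prover will establish / a refuter must break). -/
theorem gradientComparability_iff_envelope :
    GradientComparability ↔ ∀ k : ℕ, k = 2 ∨ k = 3 → ∀ γ : unitInterval → ℝ × ℝ, PathOK k γ →
      ∀ (m : ℕ) (F : Fin m → Quad (Set.univ : Set ℂ)), 0 < m → EnvelopeOn k (Set.range γ) m F := by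
  rw [gradientComparability_iff]
  refine forall₅_congr fun k _ γ _ m => forall₂_congr fun F _ => ?_
  rw [conclusion_iff_conclusionOn_range, conclusionOn_iff_envelopeOn (Set.range_nonempty γ)]

/-! ## §4 Load-bearing hypothesis `0 < m` (the empty quad family) -/

/-- The coin-to-edge map is measurable, so `M k ρ c` is the honest push-forward (no
`Measure.map` junk) and a probability measure. -/
theorem measurable_cfg (k : ℕ) : Measurable (cfg k) := by
  refine measurable_set_iff.2 fun e => ?_
  refine measurableSet_setOf.1 ?_
  change MeasurableSet {S : Set (Site 2 × Fin 2 × Fin 3) |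
    ∃ (v : Site 2) (d : Fin 2), e = s(v, v + (if d = 0 then ![1, 0] else ![0, 1])) ∧ opn k S (v, d)}
  have hopn : ∀ (v : Site 2) (d : Fin 2),
      MeasurableSet {S : Set (Site 2 × Fin 2 × Fin 3) | opn k S (v, d)} := by
    intro v d
    by_cases hax : ax k (v, d)
    · simp only [opn, hax, if_true, Set.setOf_or, Set.setOf_and]
      exact ((measurableSet_mem _).inter (measurableSet_mem _)).union
        ((measurableSet_notMem _).inter (measurableSet_mem _))
    · simp only [opn, hax, if_false]
      exact measurableSet_mem _
  have : {S : Set (Site 2 × Fin 2 × Fin 3) |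
      ∃ (v : Site 2) (d : Fin 2), e = s(v, v + (if d = 0 then ![1, 0] else ![0, 1])) ∧ opn k S (v, d)} =
      ⋃ (v : Site 2) (d : Fin 2),
        ({S | e = s(v, v + (if d = 0 then ![1, 0] else ![0, 1]))} ∩ {S | opn k S (v, d)}) := by
    ext S; simp only [Set.mem_setOf_eq, Set.mem_iUnion, Set.mem_inter_iff]
  rw [this]
  exact MeasurableSet.iUnion fun v => MeasurableSet.iUnion fun d =>
    (MeasurableSet.const _).inter (hopn v d)

instance instIsProbabilityMeasureM (k : ℕ) (ρ c : ℝ) : IsProbabilityMeasure (M k ρ c) :=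
  Measure.isProbabilityMeasure_map (measurable_cfg k).aemeasurable

/-- With the EMPTY quad family the joint crossing event is everything … -/
theorem A_zero (F : Fin 0 → Quad (Set.univ : Set ℂ)) (η : ℝ) : A 0 F η = Set.univ :=
  Set.eq_univ_of_forall fun _ i => i.elim0

/-- … its probability is identically `1` … -/
theorem P_zero (k : ℕ) (F : Fin 0 → Quad (Set.univ : Set ℂ)) (η ρ c : ℝ) : P k 0 F η ρ c = 1 := by
  simp only [P, A_zero, probReal_univ]

/-- … so both Russo derivatives vanish identically … -/
theorem Dρ_zero (k : ℕ) (F : Fin 0 → Quad (Set.univ : Set ℂ)) (η : ℝ) (q : ℝ × ℝ) :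
    Dρ k 0 F η q = 0 := by
  simp only [Dρ, P_zero]
  exact congrFun (derivWithin_fun_const (𝕜 := ℝ) _ _) _

theorem Dc_zero (k : ℕ) (F : Fin 0 → Quad (Set.univ : Set ℂ)) (η : ℝ) (q : ℝ × ℝ) :
    Dc k 0 F η q = 0 := by
  simp only [Dc, P_zero]
  exact congrFun (derivWithin_fun_const (𝕜 := ℝ) _ _) _

/-- … and the gradient size is identically `0`. -/
theorem G_zero (k : ℕ) (F : Fin 0 → Quad (Set.univ : Set ℂ)) (η : ℝ) (q : ℝ × ℝ) :
    G k 0 F η q = 0 := by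
  simp only [G, Dρ_zero, Dc_zero, abs_zero, add_zero]

/-- The divergence clause fails for the empty family on ANY path. -/
theorem not_conclusion_zero (k : ℕ) (γ : unitInterval → ℝ × ℝ) (F : Fin 0 → Quad (Set.univ : Set ℂ)) :
    ¬ Conclusion k γ 0 F := by
  rintro ⟨Λ, η₀, hη₀, -, hdiv⟩
  obtain ⟨η₁, hη₁, h⟩ := hdiv 1
  have := h (η₁ / 2) ⟨by positivity, by linarith⟩ 0
  rw [G_zero] at this
  exact absurd this (by norm_num)

/-- The crux with the guard `0 < m` dropped. -/
def GradientComparabilityWithoutPosM : Prop :=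
  ∀ k : ℕ, k = 2 ∨ k = 3 → ∀ γ : unitInterval → ℝ × ℝ, PathOK k γ →
    ∀ (m : ℕ) (F : Fin m → Quad (Set.univ : Set ℂ)), Conclusion k γ m F

/-- **`0 < m` is load-bearing**: without it the crux is equivalent to the NON-existence of RSW paths
(i.e. to the failure of `CriticalPathRSW` for both `k`). -/
theorem withoutPosM_iff_noPath :
    GradientComparabilityWithoutPosM ↔ ∀ k : ℕ, k = 2 ∨ k = 3 → ∀ γ, ¬ PathOK k γ := by
  constructor
  · intro h k hk γ hγ
    exact not_conclusion_zero k γ (fun i => i.elim0) (h k hk γ hγ 0 _)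
  · intro h k hk γ hγ
    exact (h k hk γ hγ).elim

/-- In particular `CriticalPathRSW` refutes the unguarded crux ("any proof must use `0 < m`"). -/
theorem criticalPathRSW_imp_not_withoutPosM : CriticalPathRSW → ¬ GradientComparabilityWithoutPosM := by
  intro hC hW
  obtain ⟨γ, hγ⟩ := criticalPathRSW_iff.1 hC 2 (Or.inl rfl)
  exact withoutPosM_iff_noPath.1 hW 2 (Or.inl rfl) γ hγ

/-! ## §5 What the crux asserts about the two explicit Bernoulli endpoints -/

/-- Given an RSW path, the crux forces divergence of the Russo gradient of the own-coin model at
BOTH explicit endpoints — `(1,0)` (the `k`-refinement of coarse `P_{1/2}`) and `(0,½)` (`P_{1/2}`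
itself) — and their mutual comparability at equal mesh.  On paper both consequences are TRUE
(Reimer/BK: `n² π₄(n) ≥ n²π₅(n)/π₁(n) → ∞` on bond-`ℤ²`; quasi-multiplicativity gives
`π₄(kn) ≍ π₄(n)`), so the endpoints alone cannot refute the crux: the only undecided content sits
at interior points of the path (dependent models), see the docblock. -/
theorem gradientComparability_endpoints (hGC : GradientComparability) {k : ℕ} (hk : k = 2 ∨ k = 3)
    {γ : unitInterval → ℝ × ℝ} (hγ : PathOK k γ) (m : ℕ) (F : Fin m → Quad (Set.univ : Set ℂ))
    (hm : 0 < m) : ConclusionOn k {((1 : ℝ), (0 : ℝ)), ((0 : ℝ), (1 / 2 : ℝ))} m F := by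
  have h := (conclusion_iff_conclusionOn_range k γ m F).1 (gradientComparability_iff.1 hGC k hk γ hγ m F hm)
  refine h.mono ?_
  intro q hq
  rcases hq with rfl | rfl
  · exact (endpoints_mem_range hγ).1
  · exact (endpoints_mem_range hγ).2


/-- Divergence of the gradient size at ONE parameter point. -/
def DivergesAt (k : ℕ) (q : ℝ × ℝ) (m : ℕ) (F : Fin m → Quad (Set.univ : Set ℂ)) : Prop :=
  ∀ N : ℝ, ∃ η₁ : ℝ, 0 < η₁ ∧ ∀ η ∈ Set.Ioo 0 η₁, N ≤ G k m F η q

/-- Unpacking the conclusion on a two-point parameter set: two-sided comparability at equal mesh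
plus divergence at each point. -/
theorem conclusionOn_pair_iff {k : ℕ} {p q : ℝ × ℝ} {m : ℕ} {F : Fin m → Quad (Set.univ : Set ℂ)} :
    ConclusionOn k {p, q} m F ↔
      (∃ Λ η₀ : ℝ, 0 < η₀ ∧ ∀ η ∈ Set.Ioo 0 η₀,
          G k m F η p ≤ Λ * G k m F η q ∧ G k m F η q ≤ Λ * G k m F η p) ∧
        DivergesAt k p m F ∧ DivergesAt k q m F := by
  constructor
  · rintro ⟨Λ, η₀, hη₀, hcomp, hdiv⟩
    refine ⟨⟨Λ, η₀, hη₀, fun η hη => ⟨hcomp p (by simp) q (by simp) η hη, hcomp q (by simp) p (by simp) η hη⟩⟩,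
      fun N => ?_, fun N => ?_⟩
    · obtain ⟨η₁, hη₁, h⟩ := hdiv N
      exact ⟨η₁, hη₁, fun η hη => h η hη p (by simp)⟩
    · obtain ⟨η₁, hη₁, h⟩ := hdiv N
      exact ⟨η₁, hη₁, fun η hη => h η hη q (by simp)⟩
  · rintro ⟨⟨Λ, η₀, hη₀, hcomp⟩, hp, hq⟩
    refine ⟨max Λ 1, η₀, hη₀, ?_, fun N => ?_⟩
    · intro x hx y hy η hη
      have hΛ : Λ ≤ max Λ 1 := le_max_left _ _
      have h1 : (1 : ℝ) ≤ max Λ 1 := le_max_right _ _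
      have hGx : 0 ≤ G k m F η x := by positivity
      have hGy : 0 ≤ G k m F η y := by positivity
      simp only [Set.mem_insert_iff, Set.mem_singleton_iff] at hx hy
      rcases hx with rfl | rfl <;> rcases hy with rfl | rfl
      · nlinarith
      · calc G k m F η x ≤ Λ * G k m F η y := (hcomp η hη).1
          _ ≤ max Λ 1 * G k m F η y := by gcongr
      · calc G k m F η x ≤ Λ * G k m F η y := (hcomp η hη).2
          _ ≤ max Λ 1 * G k m F η y := by gcongr
      · nlinarith
    · obtain ⟨η₁, hη₁, h₁⟩ := hp N
      obtain ⟨η₂, hη₂, h₂⟩ := hq N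
      refine ⟨min η₁ η₂, lt_min hη₁ hη₂, fun η hη x hx => ?_⟩
      simp only [Set.mem_insert_iff, Set.mem_singleton_iff] at hx
      rcases hx with rfl | rfl
      · exact h₁ η ⟨hη.1, lt_of_lt_of_le hη.2 (min_le_left _ _)⟩
      · exact h₂ η ⟨hη.1, lt_of_lt_of_le hη.2 (min_le_right _ _)⟩

/-- Hence, given an RSW path, the crux asserts in particular: the Russo gradient of the own-coin
model diverges at `(1,0)` and at `(0,½)`, and the two are comparable at equal mesh. -/
theorem gradientComparability_endpoints' (hGC : GradientComparability) {k : ℕ} (hk : k = 2 ∨ k = 3)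
    {γ : unitInterval → ℝ × ℝ} (hγ : PathOK k γ) (m : ℕ) (F : Fin m → Quad (Set.univ : Set ℂ))
    (hm : 0 < m) :
    (∃ Λ η₀ : ℝ, 0 < η₀ ∧ ∀ η ∈ Set.Ioo 0 η₀,
        G k m F η (1, 0) ≤ Λ * G k m F η (0, 1 / 2) ∧ G k m F η (0, 1 / 2) ≤ Λ * G k m F η (1, 0)) ∧
      DivergesAt k (1, 0) m F ∧ DivergesAt k (0, 1 / 2) m F :=
  conclusionOn_pair_iff.1 (gradientComparability_endpoints hGC hk hγ m F hm)


/-! ## §5b Structure used above and by provers: `A` is increasing; `P` is monotone in `c`;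
`∂cP ≥ 0` (so `G = |∂ρP| + ∂cP`) — the last two modulo measurability of the crossing event,
which is NOT in the tree (`configOf` measurability is flagged as "left to a proof file" in
`QuadCrossingSpace`); without it `P` is an outer measure and no Russo formula is available. -/

theorem openEdgeRealization_mono' {V : Type*} (z : V → ℂ) (δ : ℝ) {ω ω' : BondConfig V}
    (h : ω ⊆ ω') : openEdgeRealization z δ ω ⊆ openEdgeRealization z δ ω' := by
  rintro w ⟨x, y, hxy, hw⟩
  exact ⟨x, y, h hxy, hw⟩

/-- The joint crossing event is increasing in the bond configuration. -/
theorem isUpperSet_A (m : ℕ) (F : Fin m → Quad (Set.univ : Set ℂ)) (η : ℝ) : IsUpperSet (A m F η) := by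
  intro ω ω' hle hω i
  have hmono := configOfSet_mono (D := (Set.univ : Set ℂ))
    (openEdgeRealization_mono' squareLatticeEmbedding.z η hle)
  exact hmono (hω i)

/-- Raising `c` only lowers thresholds of own coins of NON-axial edges, in which the read-out is
monotone: the label coupling is pointwise monotone in `c` through `cfg`. -/
theorem cfg_threshold_mono_c (k : ℕ) (ρ : ℝ) {c c' : ℝ} (hcc : c ≤ c')
    (U : Site 2 × Fin 2 × Fin 3 → ℝ) :
    cfg k {i | U i ≤ (prm k ρ c i : ℝ)} ⊆ cfg k {i | U i ≤ (prm k ρ c' i : ℝ)} := by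
  rintro e ⟨v, d, rfl, hopn⟩
  refine ⟨v, d, rfl, ?_⟩
  by_cases hax : ax k (v, d)
  · have h2 : (prm k ρ c (tb k (v, d), d, 2) : ℝ) = prm k ρ c' (tb k (v, d), d, 2) := by simp [prm]
    have h1 : (prm k ρ c (tb k (v, d), d, 1) : ℝ) = prm k ρ c' (tb k (v, d), d, 1) := by simp [prm]
    have h0 : (prm k ρ c (v, d, 0) : ℝ) = prm k ρ c' (v, d, 0) := by simp [prm, hax]
    simp only [opn, hax, if_true, Set.mem_setOf_eq] at hopn ⊢
    rwa [h2, h1, h0] at hopn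
  · have hle : (prm k ρ c (v, d, 0) : ℝ) ≤ prm k ρ c' (v, d, 0) := by
      simp only [prm, hax, Fin.isValue, ↓reduceIte]
      exact Subtype.coe_le_coe.2 (Set.monotone_projIcc zero_le_one hcc)
    simp only [opn, hax, if_false, Set.mem_setOf_eq] at hopn ⊢
    exact hopn.trans hle

private theorem measurable_threshold (r : Site 2 × Fin 2 × Fin 3 → unitInterval) :
    Measurable fun U : Site 2 × Fin 2 × Fin 3 → ℝ => {i | U i ≤ (r i : ℝ)} :=
  measurable_set_iff.2 fun i =>
    (show Measurable fun t : ℝ => (t ≤ (r i : ℝ)) from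
      measurableSet_setOf.1 measurableSet_Iic).comp (measurable_pi_apply i)

/-- **Monotonicity of `M_k(ρ,c)` in `c` on increasing measurable events** (label coupling,
Grimmett 1999 Thm 2.1, run through the non-monotone read-out `cfg`). -/
theorem M_apply_mono_c (k : ℕ) (ρ : ℝ) {c c' : ℝ} (hcc : c ≤ c') {E : Set (BondConfig (Site 2))}
    (hE : IsUpperSet E) (hEm : MeasurableSet E) : M k ρ c E ≤ M k ρ c' E := by
  simp only [M]
  rw [Measure.map_apply (measurable_cfg k) hEm, Measure.map_apply (measurable_cfg k) hEm,
    prodBernoulli_eq_map_labels, prodBernoulli_eq_map_labels,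
    Measure.map_apply (measurable_threshold _) (measurable_cfg k hEm),
    Measure.map_apply (measurable_threshold _) (measurable_cfg k hEm)]
  refine measure_mono fun U hU => ?_
  exact hE (cfg_threshold_mono_c k ρ hcc U) hU

theorem M_real_mono_c (k : ℕ) (ρ : ℝ) {c c' : ℝ} (hcc : c ≤ c') {E : Set (BondConfig (Site 2))}
    (hE : IsUpperSet E) (hEm : MeasurableSet E) : (M k ρ c).real E ≤ (M k ρ c').real E :=
  ENNReal.toReal_mono (measure_ne_top _ _) (M_apply_mono_c k ρ hcc hE hEm)

/-- `P` is monotone in `c` — GIVEN measurability of the joint crossing event. -/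
theorem P_mono_c (k m : ℕ) (F : Fin m → Quad (Set.univ : Set ℂ)) (η ρ : ℝ)
    (hA : MeasurableSet (A m F η)) : Monotone fun c => P k m F η ρ c :=
  fun _ _ hcc => M_real_mono_c k ρ hcc (isUpperSet_A m F η) hA

/-- Hence `∂cP ≥ 0` wherever it is taken (Mathlib `MonotoneOn.derivWithin_nonneg`; the junk value
`0` at non-differentiable points is also `≥ 0`), so `G = |∂ρP| + ∂cP` — GIVEN measurability. -/
theorem Dc_nonneg (k m : ℕ) (F : Fin m → Quad (Set.univ : Set ℂ)) (η : ℝ) (q : ℝ × ℝ)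
    (hA : MeasurableSet (A m F η)) : 0 ≤ Dc k m F η q :=
  ((P_mono_c k m F η q.1 hA).monotoneOn _).derivWithin_nonneg


/-! ## §5c Support of `M_k(ρ,c)`: only nearest-neighbour edges are ever open, so every event may
be replaced by its trace on the full-measure set `nnSupport` (first step of the measurability
programme flagged in the docblock). -/

theorem dirVec_eq_single (d : Fin 2) :
    ((if d = 0 then ![1, 0] else ![0, 1]) : Site 2) = Pi.single d 1 := by
  fin_cases d <;> (ext i; fin_cases i <;> simp)

/-- The read-out only ever opens nearest-neighbour edges of `ℤ²`. -/
theorem cfg_subset_edgeSet (k : ℕ) (S : Set (Site 2 × Fin 2 × Fin 3)) :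
    cfg k S ⊆ (zdGraph 2).edgeSet := by
  rintro e ⟨v, d, rfl, -⟩
  rw [SimpleGraph.mem_edgeSet]
  exact (zdGraph_adj_iff _ _).2 ⟨d, Or.inl (by rw [dirVec_eq_single])⟩

/-- Configurations using nearest-neighbour edges only. -/
def nnSupport : Set (BondConfig (Site 2)) := {ω | ω ⊆ (zdGraph 2).edgeSet}

theorem measurableSet_nnSupport : MeasurableSet nnSupport := by
  have : nnSupport = ⋂ (x : Site 2) (y : Site 2),
      {ω : BondConfig (Site 2) | s(x, y) ∈ ω → (zdGraph 2).Adj x y} := by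
    ext ω
    simp only [nnSupport, Set.mem_setOf_eq, Set.mem_iInter]
    constructor
    · intro h x y hxy
      exact (SimpleGraph.mem_edgeSet _).1 (h hxy)
    · intro h e he
      induction e using Sym2.ind with
      | h x y => exact (SimpleGraph.mem_edgeSet _).2 (h x y he)
  rw [this]
  refine MeasurableSet.iInter fun x => MeasurableSet.iInter fun y => ?_
  by_cases hadj : (zdGraph 2).Adj x y
  · simp only [hadj, imp_true_iff, Set.setOf_true]
    exact MeasurableSet.univ
  · simp only [hadj, imp_false]
    exact measurableSet_notMem _

/-- `M_k(ρ,c)` gives full mass to `nnSupport` … -/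
theorem M_nnSupport (k : ℕ) (ρ c : ℝ) : M k ρ c nnSupport = 1 := by
  simp only [M]
  rw [Measure.map_apply (measurable_cfg k) measurableSet_nnSupport]
  have : cfg k ⁻¹' nnSupport = Set.univ :=
    Set.eq_univ_of_forall fun S => cfg_subset_edgeSet k S
  rw [this, measure_univ]

/-- … so its complement is null … -/
theorem M_compl_nnSupport (k : ℕ) (ρ c : ℝ) : M k ρ c nnSupportᶜ = 0 :=
  (prob_compl_eq_zero_iff measurableSet_nnSupport).2 (M_nnSupport k ρ c)

/-- … and EVERY set (measurable or not: `Measure` is an outer measure) has the same mass as its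
trace on `nnSupport`.  In particular `P k m F η ρ c = (M k ρ c).real (A m F η ∩ nnSupport)`, and
`A m F η ∩ nnSupport` is the finite-dimensional cylinder candidate. -/
theorem M_eq_inter_nnSupport (k : ℕ) (ρ c : ℝ) (E : Set (BondConfig (Site 2))) :
    M k ρ c E = M k ρ c (E ∩ nnSupport) := by
  have h := measure_inter_add_sdiff₀ (μ := M k ρ c) E measurableSet_nnSupport.nullMeasurableSet
  have h0 : M k ρ c (E \ nnSupport) = 0 :=
    measure_mono_null (Set.sdiff_subset_compl _ _) (M_compl_nnSupport k ρ c)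
  rw [h0, add_zero] at h
  exact h.symm

theorem P_eq_inter_nnSupport (k m : ℕ) (F : Fin m → Quad (Set.univ : Set ℂ)) (η ρ c : ℝ) :
    P k m F η ρ c = (M k ρ c).real (A m F η ∩ nnSupport) := by
  simp only [P, Measure.real, M_eq_inter_nnSupport k ρ c (A m F η)]


/-! ## §5d Localisation: the crossing event of a quad depends only on the edges drawn within
uniform distance `1` of `[Q]`; on `nnSupport` these are finitely many (for `η ≠ 0`), so the trace
`A ∩ nnSupport` is a finite-dimensional cylinder, hence MEASURABLE — which makes §5b unconditional
(`P_mono_c'`, `Dc_nonneg'`) and is the entry point of every Russo computation on this route. -/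

/-- pairs of sites whose drawn segment at mesh `η` meets `B`. -/
def pairsNear (η : ℝ) (B : Set ℂ) : Set (Sym2 (Site 2)) :=
  {e | ∃ x y : Site 2, e = s(x, y) ∧
    (segment ℝ ((η : ℂ) * squareLatticeEmbedding.z x) ((η : ℂ) * squareLatticeEmbedding.z y) ∩ B).Nonempty}

/-- nearest-neighbour edges whose drawn segment at mesh `η` meets `B`. -/
def edgesNear (η : ℝ) (B : Set ℂ) : Set (Sym2 (Site 2)) := pairsNear η B ∩ (zdGraph 2).edgeSet

theorem openEdgeRealization_inter_subset (η : ℝ) (B : Set ℂ) (ω : BondConfig (Site 2)) :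
    openEdgeRealization squareLatticeEmbedding.z η ω ∩ B ⊆
      openEdgeRealization squareLatticeEmbedding.z η (ω ∩ pairsNear η B) := by
  rintro w ⟨⟨x, y, hxy, hw⟩, hwB⟩
  exact ⟨x, y, ⟨hxy, x, y, rfl, w, hw, hwB⟩, hw⟩

/-- Quads at uniform distance `< 1` from `Q` have their carrier in the `1`-thickening of `[Q]`. -/
theorem carrier_subset_thickening {Q Q' : Quad (Set.univ : Set ℂ)} (h : dist Q' Q < 1) :
    Q'.carrier ⊆ Metric.thickening 1 Q.carrier := by
  rintro w ⟨z, rfl⟩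
  exact Metric.mem_thickening_iff.2 ⟨Q z, ⟨z, rfl⟩, lt_of_le_of_lt (Quad.dist_apply_le Q' Q z) h⟩

/-- **Localisation (sandwich form).** If `ω'` lies between `ω ∩ pairsNear η (thickening 1 [Q])`
and `ω`, then `Q` is crossed (in the `configOf` = closure sense) by `ω` iff by `ω'`. -/
theorem mem_configOf_iff_of_sandwich (η : ℝ) (Q : Quad (Set.univ : Set ℂ)) {ω ω' : BondConfig (Site 2)}
    (h₁ : ω ∩ pairsNear η (Metric.thickening 1 Q.carrier) ⊆ ω') (h₂ : ω' ⊆ ω) :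
    Q ∈ configOf squareLatticeEmbedding.z η Set.univ ω ↔
      Q ∈ configOf squareLatticeEmbedding.z η Set.univ ω' := by
  constructor
  · intro hQ
    change Q ∈ closure (rawCrossedSet (openEdgeRealization squareLatticeEmbedding.z η ω)
      (Set.univ : Set ℂ)) at hQ
    change Q ∈ closure (rawCrossedSet (openEdgeRealization squareLatticeEmbedding.z η ω')
      (Set.univ : Set ℂ))
    rw [Metric.mem_closure_iff] at hQ ⊢
    intro ε hε
    obtain ⟨Q', hQ'raw, hQ'd⟩ := hQ (min ε 1) (lt_min hε one_pos)
    refine ⟨Q', ?_, lt_of_lt_of_le hQ'd (min_le_left _ _)⟩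
    obtain ⟨K, hK, hKω⟩ := hQ'raw
    refine ⟨K, hK, ?_⟩
    have hKB : K ⊆ Metric.thickening 1 Q.carrier :=
      hK.2.2.1.trans (carrier_subset_thickening
        (by rw [dist_comm]; exact lt_of_lt_of_le hQ'd (min_le_right _ _)))
    exact ((Set.subset_inter hKω hKB).trans (openEdgeRealization_inter_subset η _ ω)).trans
      (openEdgeRealization_mono' _ η h₁)
  · intro hQ
    exact configOfSet_mono (D := (Set.univ : Set ℂ)) (openEdgeRealization_mono' _ η h₂) hQ

/-! ### finiteness of the window on `nnSupport` -/

theorem abs_coord_le_norm_z (x : Site 2) (i : Fin 2) :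
    |(x i : ℝ)| ≤ ‖squareLatticeEmbedding.z x‖ := by
  have h1 : ‖squareLatticeEmbedding.z x‖ = Real.sqrt 2 * ‖Site.toComplex x‖ := by
    show ‖((Real.sqrt 2 : ℝ) : ℂ) * Site.toComplex x‖ = _
    rw [norm_mul, Complex.norm_real, Real.norm_of_nonneg (Real.sqrt_nonneg _)]
  have hsq : (1 : ℝ) ≤ Real.sqrt 2 := by
    rw [show (1 : ℝ) = Real.sqrt 1 by simp]
    exact Real.sqrt_le_sqrt (by norm_num)
  have h2 : ‖Site.toComplex x‖ ≤ ‖squareLatticeEmbedding.z x‖ := by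
    rw [h1]; nlinarith [norm_nonneg (Site.toComplex x)]
  have h3 : |(x i : ℝ)| ≤ ‖Site.toComplex x‖ := by
    fin_cases i
    · simpa using Complex.abs_re_le_norm (Site.toComplex x)
    · simpa using Complex.abs_im_le_norm (Site.toComplex x)
  exact h3.trans h2

theorem adj_coord_sub_abs_le {x y : Site 2} (h : (zdGraph 2).Adj x y) (i : Fin 2) :
    |(x i : ℝ) - (y i : ℝ)| ≤ 1 := by
  obtain ⟨j, hj | hj⟩ := (zdGraph_adj_iff x y).1 h
  · subst hj
    by_cases hij : i = j
    · subst hij; simp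
    · simp [hij]
  · subst hj
    by_cases hij : i = j
    · subst hij; simp
    · simp [hij]

theorem norm_toComplex_sub_le_of_adj {x y : Site 2} (h : (zdGraph 2).Adj x y) :
    ‖Site.toComplex x - Site.toComplex y‖ ≤ 2 := by
  have h0 := adj_coord_sub_abs_le h 0
  have h1 := adj_coord_sub_abs_le h 1
  have hre : (Site.toComplex x - Site.toComplex y).re = (x 0 : ℝ) - y 0 := by simp [Site.toComplex]
  have him : (Site.toComplex x - Site.toComplex y).im = (x 1 : ℝ) - y 1 := by simp [Site.toComplex]
  calc ‖Site.toComplex x - Site.toComplex y‖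
      ≤ |(Site.toComplex x - Site.toComplex y).re| + |(Site.toComplex x - Site.toComplex y).im| :=
        Complex.norm_le_abs_re_add_abs_im _
    _ ≤ 2 := by rw [hre, him]; linarith

theorem dist_z_le_of_adj {x y : Site 2} (h : (zdGraph 2).Adj x y) (η : ℝ) :
    dist ((η : ℂ) * squareLatticeEmbedding.z x) ((η : ℂ) * squareLatticeEmbedding.z y) ≤
      2 * Real.sqrt 2 * |η| := by
  rw [dist_eq_norm, ← mul_sub, norm_mul, Complex.norm_real, Real.norm_eq_abs]
  have hz : squareLatticeEmbedding.z x - squareLatticeEmbedding.z y =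
      ((Real.sqrt 2 : ℝ) : ℂ) * (Site.toComplex x - Site.toComplex y) := by
    show ((Real.sqrt 2 : ℝ) : ℂ) * Site.toComplex x - ((Real.sqrt 2 : ℝ) : ℂ) * Site.toComplex y = _
    ring
  rw [hz, norm_mul, Complex.norm_real, Real.norm_of_nonneg (Real.sqrt_nonneg _)]
  have := norm_toComplex_sub_le_of_adj h
  have hη := abs_nonneg η
  have hs := Real.sqrt_nonneg 2
  calc |η| * (Real.sqrt 2 * ‖Site.toComplex x - Site.toComplex y‖)
      ≤ |η| * (Real.sqrt 2 * 2) := by gcongr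
    _ = 2 * Real.sqrt 2 * |η| := by ring

/-- For `η ≠ 0`, only finitely many nearest-neighbour edges are drawn through a bounded set. -/
theorem edgesNear_finite {η : ℝ} (hη : η ≠ 0) {B : Set ℂ} (hB : Bornology.IsBounded B) :
    (edgesNear η B).Finite := by
  obtain ⟨R, hR⟩ := hB.subset_closedBall 0
  obtain ⟨N, hN⟩ : ∃ N : ℕ, max R 0 / |η| + 2 * Real.sqrt 2 ≤ N := exists_nat_ge _
  have hη' : 0 < |η| := abs_pos.2 hη
  have key : ∀ x y : Site 2, (zdGraph 2).Adj x y →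
      (segment ℝ ((η : ℂ) * squareLatticeEmbedding.z x) ((η : ℂ) * squareLatticeEmbedding.z y) ∩ B).Nonempty →
      x ∈ (box 2 N : Finset (Site 2)) := by
    intro x y hadj hne
    obtain ⟨w, hw, hwB⟩ := hne
    have hwR : ‖w‖ ≤ max R 0 := by
      have := hR hwB
      rw [Metric.mem_closedBall, dist_zero_right] at this
      exact this.trans (le_max_left _ _)
    have hseg := segment_subset_closedBall_left _ _ hw
    rw [Metric.mem_closedBall] at hseg
    have hdist := dist_z_le_of_adj hadj η
    have ha : ‖(η : ℂ) * squareLatticeEmbedding.z x‖ ≤ max R 0 + 2 * Real.sqrt 2 * |η| := by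
      have h1 : ‖(η : ℂ) * squareLatticeEmbedding.z x‖ ≤ ‖w‖ + ‖(η : ℂ) * squareLatticeEmbedding.z x - w‖ :=
        norm_le_norm_add_norm_sub' _ _
      rw [← dist_eq_norm, dist_comm] at h1
      linarith
    rw [norm_mul, Complex.norm_real, Real.norm_eq_abs] at ha
    have hz : ‖squareLatticeEmbedding.z x‖ ≤ N := by
      have : ‖squareLatticeEmbedding.z x‖ ≤ max R 0 / |η| + 2 * Real.sqrt 2 := by
        rw [div_add' _ _ _ hη'.ne', le_div_iff₀ hη']
        nlinarith
      exact this.trans hN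
    rw [mem_box]
    intro i
    have hi := (abs_coord_le_norm_z x i).trans hz
    rw [abs_le] at hi
    constructor
    · have : (((-(N : ℤ)) : ℤ) : ℝ) ≤ ((x i : ℤ) : ℝ) := by push_cast; linarith [hi.1]
      exact_mod_cast this
    · have : ((x i : ℤ) : ℝ) ≤ ((N : ℤ) : ℝ) := by push_cast; linarith [hi.2]
      exact_mod_cast this
  refine ((((box 2 N : Finset (Site 2)).finite_toSet.prod (box 2 N : Finset (Site 2)).finite_toSet).image
    fun p : Site 2 × Site 2 => s(p.1, p.2)).subset ?_)
  rintro e ⟨⟨x, y, rfl, hseg⟩, he⟩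
  have hadj : (zdGraph 2).Adj x y := (SimpleGraph.mem_edgeSet _).1 he
  refine ⟨(x, y), ⟨key x y hadj hseg, key y x hadj.symm ?_⟩, rfl⟩
  rwa [segment_symm]

/-- the finite window of nearest-neighbour edges that can matter for the family `F` at mesh `η` -/
def window (m : ℕ) (F : Fin m → Quad (Set.univ : Set ℂ)) (η : ℝ) : Set (Sym2 (Site 2)) :=
  ⋃ i, edgesNear η (Metric.thickening 1 (F i).carrier)

theorem window_finite (m : ℕ) (F : Fin m → Quad (Set.univ : Set ℂ)) {η : ℝ} (hη : η ≠ 0) :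
    (window m F η).Finite :=
  Set.finite_iUnion fun i =>
    edgesNear_finite hη ((F i).isCompact_carrier.isBounded.thickening)

/-- **On `nnSupport` the joint crossing event is decided by the finite window.** -/
theorem mem_A_iff_inter_window {m : ℕ} (F : Fin m → Quad (Set.univ : Set ℂ)) (η : ℝ)
    {ω : BondConfig (Site 2)} (hω : ω ∈ nnSupport) :
    ω ∈ A m F η ↔ ω ∩ window m F η ∈ A m F η := by
  refine forall_congr' fun i => mem_configOf_iff_of_sandwich η (F i) ?_ Set.inter_subset_left
  rintro e ⟨heω, hep⟩
  exact ⟨heω, Set.mem_iUnion.2 ⟨i, hep, hω heω⟩⟩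

/-- the localised (cylinder) version of the joint crossing event -/
def Aloc (m : ℕ) (F : Fin m → Quad (Set.univ : Set ℂ)) (η : ℝ) : Set (BondConfig (Site 2)) :=
  {ω | ω ∩ window m F η ∈ A m F η}

theorem A_inter_nnSupport_eq (m : ℕ) (F : Fin m → Quad (Set.univ : Set ℂ)) (η : ℝ) :
    A m F η ∩ nnSupport = Aloc m F η ∩ nnSupport := by
  ext ω
  simp only [Set.mem_inter_iff, Aloc, Set.mem_setOf_eq]
  constructor
  · rintro ⟨hA, hω⟩; exact ⟨(mem_A_iff_inter_window F η hω).1 hA, hω⟩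
  · rintro ⟨hA, hω⟩; exact ⟨(mem_A_iff_inter_window F η hω).2 hA, hω⟩

theorem isUpperSet_Aloc (m : ℕ) (F : Fin m → Quad (Set.univ : Set ℂ)) (η : ℝ) :
    IsUpperSet (Aloc m F η) := fun _ _ hle hω =>
  isUpperSet_A m F η (Set.inter_subset_inter_left _ hle) hω

/-- events decided by a finite set of coordinates are measurable (finite union of cylinders). -/
theorem measurableSet_setOf_inter_mem {W : Set (Sym2 (Site 2))} (hW : W.Finite)
    (E : Set (BondConfig (Site 2))) :
    MeasurableSet {ω : BondConfig (Site 2) | ω ∩ W ∈ E} := by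
  have hrepr : {ω : BondConfig (Site 2) | ω ∩ W ∈ E} =
      ⋃ T ∈ {T : Set (Sym2 (Site 2)) | T ⊆ W ∧ T ∈ E}, {ω | ω ∩ W = T} := by
    ext ω
    simp only [Set.mem_setOf_eq, Set.mem_iUnion, exists_prop]
    constructor
    · intro h; exact ⟨ω ∩ W, ⟨Set.inter_subset_right, h⟩, rfl⟩
    · rintro ⟨T, ⟨-, hT⟩, hωT⟩; rwa [hωT]
  rw [hrepr]
  refine Set.Finite.measurableSet_biUnion (hW.finite_subsets.subset fun T hT => hT.1) fun T hT => ?_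
  have hTW : T ⊆ W := hT.1
  have hcyl : {ω : BondConfig (Site 2) | ω ∩ W = T} = ⋂ e ∈ W, {ω | e ∈ ω ↔ e ∈ T} := by
    ext ω
    simp only [Set.mem_setOf_eq, Set.mem_iInter]
    constructor
    · intro h e he
      rw [← h]
      exact ⟨fun heω => ⟨heω, he⟩, fun h' => h'.1⟩
    · intro h
      ext e
      simp only [Set.mem_inter_iff]
      constructor
      · rintro ⟨heω, heW⟩; exact (h e heW).1 heω
      · intro heT; exact ⟨(h e (hTW heT)).2 heT, hTW heT⟩
  rw [hcyl]
  refine Set.Finite.measurableSet_biInter hW fun e _ => ?_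
  by_cases heT : e ∈ T
  · simp only [heT, iff_true]
    exact measurableSet_mem e
  · simp only [heT, iff_false]
    exact measurableSet_notMem e

theorem measurableSet_Aloc (m : ℕ) (F : Fin m → Quad (Set.univ : Set ℂ)) {η : ℝ} (hη : η ≠ 0) :
    MeasurableSet (Aloc m F η) :=
  measurableSet_setOf_inter_mem (window_finite m F hη) _

/-- **The joint crossing event is measurable up to the null set off `nnSupport`.** -/
theorem measurableSet_A_inter_nnSupport (m : ℕ) (F : Fin m → Quad (Set.univ : Set ℂ)) {η : ℝ}
    (hη : η ≠ 0) : MeasurableSet (A m F η ∩ nnSupport) := by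
  rw [A_inter_nnSupport_eq]
  exact (measurableSet_Aloc m F hη).inter measurableSet_nnSupport

/-- **`P` is the probability of a genuine finite-dimensional increasing cylinder event.** -/
theorem P_eq_real_Aloc (k m : ℕ) (F : Fin m → Quad (Set.univ : Set ℂ)) (η ρ c : ℝ) :
    P k m F η ρ c = (M k ρ c).real (Aloc m F η) := by
  rw [P_eq_inter_nnSupport, A_inter_nnSupport_eq, Measure.real, Measure.real,
    ← M_eq_inter_nnSupport]

/-- §5b made unconditional: `P` is monotone in `c` (for `η ≠ 0`) … -/
theorem P_mono_c' (k m : ℕ) (F : Fin m → Quad (Set.univ : Set ℂ)) {η : ℝ} (hη : η ≠ 0) (ρ : ℝ) :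
    Monotone fun c => P k m F η ρ c := by
  intro c c' hcc
  simp only [P_eq_real_Aloc]
  exact M_real_mono_c k ρ hcc (isUpperSet_Aloc m F η) (measurableSet_Aloc m F hη)

/-- … and `∂cP ≥ 0` unconditionally (for `η ≠ 0`), so on the crux's range `η ∈ (0, η₀)` one has
`G = |∂ρP| + ∂cP`. -/
theorem Dc_nonneg' (k m : ℕ) (F : Fin m → Quad (Set.univ : Set ℂ)) {η : ℝ} (hη : η ≠ 0)
    (q : ℝ × ℝ) : 0 ≤ Dc k m F η q :=
  ((P_mono_c' k m F hη q.1).monotoneOn _).derivWithin_nonneg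

theorem G_eq_of_ne_zero (k m : ℕ) (F : Fin m → Quad (Set.univ : Set ℂ)) {η : ℝ} (hη : η ≠ 0)
    (q : ℝ × ℝ) : G k m F η q = |Dρ k m F η q| + Dc k m F η q := by
  rw [G, abs_of_nonneg (Dc_nonneg' k m F hη q)]


/-! ## §5e Coin-side pullback: the localised event is a FINITE coin cylinder, so `P` is a finite
sum of cylinder weights — a polynomial in `(projIcc ρ, projIcc c)` (multilinear in the coin
biases).  Consequences recorded: `P` is continuous in the parameters (so for fixed `η` the gradient
size is a continuous function on the compact path: comparability AT FIXED MESH is automatic once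
`min_s G > 0`; all the content of the crux is in the uniformity as `η → 0`). -/

/-- the direction vector of a representative `(v,d)` -/
abbrev dirVec (d : Fin 2) : Site 2 := if d = 0 then ![1, 0] else ![0, 1]

/-- the edge represented by `(v,d)` -/
abbrev edgeOf (vd : Site 2 × Fin 2) : Sym2 (Site 2) := s(vd.1, vd.1 + dirVec vd.2)

theorem dirVec_apply_self (d : Fin 2) : dirVec d d = 1 := by
  fin_cases d <;> simp [dirVec]

theorem dirVec_apply_nonneg (d i : Fin 2) : 0 ≤ dirVec d i := by
  fin_cases d <;> fin_cases i <;> simp [dirVec]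

theorem edgeOf_injective : Function.Injective edgeOf := by
  rintro ⟨v, d⟩ ⟨v', d'⟩ h
  simp only [edgeOf] at h
  rw [Sym2.eq_iff] at h
  rcases h with ⟨h1, h2⟩ | ⟨h1, h2⟩
  · subst h1
    have hdd : dirVec d = dirVec d' := add_left_cancel h2
    have : d = d' := by
      have e := congrFun hdd d
      have e' := congrFun hdd d'
      fin_cases d <;> fin_cases d' <;> simp [dirVec] at e e' ⊢
    subst this
    rfl
  · exfalso
    have e1 := congrFun h1 d
    have e2 := congrFun h2 d
    simp only [Pi.add_apply] at e1 e2
    have := dirVec_apply_self d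
    have := dirVec_apply_nonneg d' d
    omega

/-- the (at most three) coins read by the edge represented by `vd` -/
def coinsOf (k : ℕ) (vd : Site 2 × Fin 2) : Set (Site 2 × Fin 2 × Fin 3) :=
  {(vd.1, vd.2, (0 : Fin 3)), (tb k vd, vd.2, (1 : Fin 3)), (tb k vd, vd.2, (2 : Fin 3))}

/-- the coins read by the edges of `W` -/
def coinWindow (k : ℕ) (W : Set (Sym2 (Site 2))) : Set (Site 2 × Fin 2 × Fin 3) :=
  ⋃ vd ∈ edgeOf ⁻¹' W, coinsOf k vd

theorem coinWindow_finite (k : ℕ) {W : Set (Sym2 (Site 2))} (hW : W.Finite) :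
    (coinWindow k W).Finite :=
  Set.Finite.biUnion (hW.preimage edgeOf_injective.injOn) fun _ _ =>
    ((Set.finite_singleton _).insert _).insert _

/-- the read-out of `vd` only depends on its three coins -/
theorem opn_congr (k : ℕ) {S S' : Set (Site 2 × Fin 2 × Fin 3)} (vd : Site 2 × Fin 2)
    (h : ∀ i ∈ coinsOf k vd, i ∈ S ↔ i ∈ S') : opn k S vd ↔ opn k S' vd := by
  obtain ⟨v, d⟩ := vd
  have h0 := h (v, d, 0) (by simp [coinsOf])
  have h1 := h (tb k (v, d), d, 1) (by simp [coinsOf])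
  have h2 := h (tb k (v, d), d, 2) (by simp [coinsOf])
  simp only [opn]
  split_ifs
  · simp only [h0, h1, h2]
  · simp only [h0]

/-- coin sets agreeing on `coinWindow k W` produce bond configurations agreeing on `W` -/
theorem cfg_inter_eq_of_agree (k : ℕ) {W : Set (Sym2 (Site 2))} {S S' : Set (Site 2 × Fin 2 × Fin 3)}
    (h : ∀ i ∈ coinWindow k W, (i ∈ S ↔ i ∈ S')) : cfg k S ∩ W = cfg k S' ∩ W := by
  have key : ∀ (v : Site 2) (d : Fin 2), s(v, v + dirVec d) ∈ W → (opn k S (v, d) ↔ opn k S' (v, d)) :=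
    fun v d heW => opn_congr k (v, d) fun i hi => h i (Set.mem_biUnion (show (v, d) ∈ edgeOf ⁻¹' W from heW) hi)
  ext e
  simp only [Set.mem_inter_iff]
  constructor
  · rintro ⟨⟨v, d, rfl, hopn⟩, heW⟩
    exact ⟨⟨v, d, rfl, (key v d heW).1 hopn⟩, heW⟩
  · rintro ⟨⟨v, d, rfl, hopn⟩, heW⟩
    exact ⟨⟨v, d, rfl, (key v d heW).2 hopn⟩, heW⟩

/-- **The pulled-back localised event is determined by the finite coin window.** -/
theorem determinedBy_preimage_Aloc (k m : ℕ) (F : Fin m → Quad (Set.univ : Set ℂ)) (η : ℝ) :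
    DeterminedBy ((cfg k) ⁻¹' Aloc m F η) (coinWindow k (window m F η)) := by
  rw [determinedBy_iff]
  intro S S' hSS'
  have h : ∀ i ∈ coinWindow k (window m F η), (i ∈ S ↔ i ∈ S') := fun i hi =>
    ⟨fun hS => ((Set.ext_iff.1 hSS' i).1 ⟨hS, hi⟩).1, fun hS' => ((Set.ext_iff.1 hSS' i).2 ⟨hS', hi⟩).1⟩
  simp only [Set.mem_preimage, Aloc, Set.mem_setOf_eq]
  rw [cfg_inter_eq_of_agree k h]

/-- **`P` as a finite sum of coin-cylinder weights** (polynomial / multilinear form). -/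
theorem P_eq_sum_powerset (k m : ℕ) (F : Fin m → Quad (Set.univ : Set ℂ)) {η : ℝ} (hη : η ≠ 0)
    (ρ c : ℝ) (K : Finset (Site 2 × Fin 2 × Fin 3)) (hK : (↑K : Set _) = coinWindow k (window m F η)) :
    P k m F η ρ c = ∑ S ∈ K.powerset,
      if (↑S : Set (Site 2 × Fin 2 × Fin 3)) ∈ (cfg k) ⁻¹' Aloc m F η then
        ∏ i ∈ K, (if i ∈ S then (prm k ρ c i : ℝ) else 1 - (prm k ρ c i : ℝ)) else 0 := by
  classical
  rw [P_eq_real_Aloc, Measure.real, Measure.map_apply (measurable_cfg k) (measurableSet_Aloc m F hη),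
    ← Measure.real]
  have hdet : DeterminedBy ((cfg k) ⁻¹' Aloc m F η) (↑K : Set _) := hK ▸ determinedBy_preimage_Aloc k m F η
  rw [RussoPath.prodBernoulli_real_eq_sum_powerset hdet]

/-- existence form (the window Finset exists for `η ≠ 0`) -/
theorem exists_coinFinset (k m : ℕ) (F : Fin m → Quad (Set.univ : Set ℂ)) {η : ℝ} (hη : η ≠ 0) :
    ∃ K : Finset (Site 2 × Fin 2 × Fin 3), (↑K : Set _) = coinWindow k (window m F η) :=
  ⟨(coinWindow_finite k (window_finite m F hη)).toFinset, Set.Finite.coe_toFinset _⟩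

/-- each coin bias is a continuous function of the parameters -/
theorem continuous_prm (k : ℕ) (i : Site 2 × Fin 2 × Fin 3) :
    Continuous fun q : ℝ × ℝ => (prm k q.1 q.2 i : ℝ) := by
  obtain ⟨v, d, j⟩ := i
  simp only [prm]
  split_ifs
  · exact continuous_const
  · exact continuous_subtype_val.comp (continuous_projIcc.comp continuous_snd)
  · exact continuous_const
  · exact continuous_subtype_val.comp (continuous_projIcc.comp continuous_fst)

/-- **`P` is continuous in `(ρ,c)`** (for `η ≠ 0`). -/
theorem continuous_P (k m : ℕ) (F : Fin m → Quad (Set.univ : Set ℂ)) {η : ℝ} (hη : η ≠ 0) :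
    Continuous fun q : ℝ × ℝ => P k m F η q.1 q.2 := by
  classical
  obtain ⟨K, hK⟩ := exists_coinFinset k m F hη
  have : (fun q : ℝ × ℝ => P k m F η q.1 q.2) = fun q : ℝ × ℝ => ∑ S ∈ K.powerset,
      if (↑S : Set (Site 2 × Fin 2 × Fin 3)) ∈ (cfg k) ⁻¹' Aloc m F η then
        ∏ i ∈ K, (if i ∈ S then (prm k q.1 q.2 i : ℝ) else 1 - (prm k q.1 q.2 i : ℝ)) else 0 := by
    funext q; exact P_eq_sum_powerset k m F hη q.1 q.2 K hK
  rw [this]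
  refine continuous_finsetSum _ fun S _ => ?_
  split_ifs
  · refine continuous_finsetProd _ fun i _ => ?_
    split_ifs
    · exact continuous_prm k i
    · exact continuous_const.sub (continuous_prm k i)
  · exact continuous_const

/-! ## §6 Two-sidedness of the RSW clause (near-miss, sorried — see docstring) -/

/-- `PathOK` with only the LOWER box-crossing bounds kept (crossing probabilities `≥ c₀`). -/
def PathOKLower (k : ℕ) (γ : unitInterval → ℝ × ℝ) : Prop :=
  Continuous γ ∧ γ 0 = (1, 0) ∧ γ 1 = (0, 1 / 2) ∧ (∀ s, γ s ∈ Set.Icc (0 : ℝ) 1 ×ˢ Set.Icc (0 : ℝ) 1) ∧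
    BoundedVariationOn (fun s => (γ s).1) Set.univ ∧ BoundedVariationOn (fun s => (γ s).2) Set.univ ∧
    ∀ a : ℝ, 0 < a → ∃ c₀ > 0, ∃ n₀ : ℕ, ∀ s, ∀ n : ℕ, n₀ ≤ n → ∀ w : ℂ,
      c₀ ≤ (M k (γ s).1 (γ s).2).real
          (embRectCrossing (fun v => squareLatticeEmbedding.z v - w) (a * n) n) ∧
        c₀ ≤ (M k (γ s).1 (γ s).2).real
          (embTBCrossing (fun v => squareLatticeEmbedding.z v - w) n (a * n))

/-- It is a weakening of `PathOK`. -/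
theorem PathOK.lower {k : ℕ} {γ : unitInterval → ℝ × ℝ} (h : PathOK k γ) : PathOKLower k γ := by
  obtain ⟨h1, h2, h3, h4, h5, h6, h7⟩ := h
  refine ⟨h1, h2, h3, h4, h5, h6, fun a ha => ?_⟩
  obtain ⟨c₀, hc₀, n₀, h⟩ := h7 a ha
  exact ⟨c₀, hc₀, n₀, fun s n hn w => ⟨((h s) n hn w).1.1, ((h s) n hn w).2.1⟩⟩

/-- The crux with only LOWER box-crossing bounds along the path. -/
def GradientComparabilityWithoutUpperRSW : Prop :=
  ∀ k : ℕ, k = 2 ∨ k = 3 → ∀ γ : unitInterval → ℝ × ℝ, PathOKLower k γ →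
    ∀ (m : ℕ) (F : Fin m → Quad (Set.univ : Set ℂ)), 0 < m → Conclusion k γ m F

/-- **Near-miss (not closed in this cycle): the UPPER box-crossing bound is load-bearing.**
With only lower bounds, the supercritical detour
`γ₁ : (1,0) → (1,1) → (0,1) → (0,½)` (piecewise linear, BV, inside the square) is admissible:
on `(1,c)` and `(0,c)` the law dominates the critical endpoint models (`c` only opens interior
edges), and on `(ρ,1)` every odd row and odd column of `ℤ²` is deterministically open, so boxes of
side `≥ 5` are crossed surely; but at `(ρ,1)` the joint crossing probability of `F = {unit square}`
is identically `1` in `ρ` and `1 − O((c−1)²)` in `c` (gen-1 evidence v2, `P_ge_of_rows`,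
`unitSquare_mem_configOf_of_row`), so `∂ρP = ∂cP = 0` for all `η ≤ 1/5` and the divergence clause
fails.  OBSTRUCTION to closing it here: the lower RSW bounds on the two monotone segments need
(i) stochastic monotonicity of `M k ρ ·` in `c` on `embRectCrossing` (a coupling lemma for
`prodBernoulli` with pointwise-ordered biases through the non-monotone read-out `cfg`), and
(ii) transport of the tree's proved `square_boxCrossing_holds` to `M 2 1 0` = the 2-refinement of
`P_{1/2}` (gen-1 `M_one_zero_eq`) including non-integer box sizes; (iii) the deterministic
staircase crossings at `c = 1` in the rotated drawing `squareLatticeEmbedding.z`.  Each is routine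
on paper; together ≈ 800 lines.  The symmetric mutation (drop the LOWER bound: subcritical detour
through `(0,0)`, where `G → 0` exponentially fast) is also false on paper but its uniform upper
bounds near `ρ → 1` are delicate (no stochastic order between shared and i.i.d. sub-edges). -/
theorem gradientComparability_false_without_upperRSW : ¬ GradientComparabilityWithoutUpperRSW := by
  sorry

end Summit.CriticalPhenomena.CardyFormulaZ2.Cruxes.GradientComparability.Disproof

end
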